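import Summits.BirchSwinnertonDyer.BirchSwinnertonDyer.Theorems.AlignedTransportAtTwoMainConjectureOfRankZeroBSDAtTwoCubicFieldsAsTwoTorsionFields
import Literature.NumberTheory.IwasawaTheory.NarrowClassNumberLayerTransportAlgEquivTwo
import Literature.NumberTheory.IwasawaTheory.NarrowFukudaCertificateLayerModels
import HarnessLib

/-!
# Route `AlignedTransportAtTwo`, crux C2 `MainConjectureOfRankZeroBSDAtTwo` (stmt-BirchSwinnertonDyer-22298):
# W-FREE KIDA CURRENCY — for EVERY `S₃`-cubic number field `F` (both signatures): `μ₂ = 0` for `F(√−1)^cyc` ⟺ `μ₂ = 0` for `F^cyc` AND a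
# bounded NARROW `2`-defect `ord₂ h⁺(F_n) − ord₂ h(F_n)` along the cyclotomic `ℤ₂`-tower of `F`

HONEST FRAMING. WIDTH-5 attached prover seat `bsd-line-att-p4` g32 on line `birth`; `--supports` stmt-BirchSwinnertonDyer-22298, closes nothing; BSD is NOT
proved; crux C2, its verdict and every registered stub untouched. THEOREMS ONLY (no `def`, no named fact, no `sorry`). Sequel of `…CubicFieldsAsTwoTorsionFields`
(the universal `u`-cubic; the complex-cubic W-free iff) and of the Literature companion `IwasawaTheory/NarrowClassNumberLayerTransportAlgEquivTwo` (layers of the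
cyclotomic `ℤ₂`-towers of `ℚ`-isomorphic fields are ring-isomorphic; `ord₂ h⁺`, `ord₂ h` and the narrow-defect datum transport).

WHAT. att-p3 g34 / att-p4 g26 proved, `W`-parametrised and on the models `ℚ⟮β_j⟯ ⊆ ℚ̄` (`…PointFieldCarrierCMIff` §7, `NarrowDefectBoundedOfClassicalMuAdjoinI`):
PFμ⁺(W) ⟺ «`μ₂(ℚ(β_j)) = 0` ∧ bounded narrow `2`-defect along the tower of `ℚ(β_j)`» — the kernel form of KIDA 1982, Thm. 1 (`μ₂⁺(K⁺) = 0 ⟹ μ₂(K) = 0` for a CM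
field `K`) together with its converse. Here, W-free and sign-free:

* ★★★ `forall_classicalMuVanishes_quadratic_iff_narrow_of_cubic` — **for a cubic number field `F ∋ e` with `e³ + Ae² + Be + C = 0` (`x³ + Ax² + Bx + C` without rational
  root; discriminant `D` with `D, 2D, −2D ∉ ℚ²` — an `S₃`-cubic whose resolvent is neither `ℚ(√2)` nor `ℚ(√−2)`) and a quadratic extension `F′/F ∋ √−1`:
  «`μ = 0` (growth form) for every cyclotomic `ℤ₂`-extension of `F′`» ⟺ «`μ = 0` for every cyclotomic `ℤ₂`-extension of `F`» ∧ «`∃ D₀, ∀` cyclotomic `κ` of `F`,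
  `∀ n`, `ord₂ h⁺(F_n) ≤ ord₂ h(F_n) + D₀`».** (Universal curve `W_{A,B,C}`; this seat's `…CMSexticCurrency` for `F′`; att-p3 g34's §7; g31's cubic transport and
  this seat's narrow layer transport along `ℚ⟮β₀⟯ ≃ₐ[ℚ] F`.)
* READING. With `…CMSexticFieldDoor.crux_of_forall_cubicField_adjoin_sqrt_neg_one_classicalMu` (C2 ⟸ ICM6 := «`μ₂ = 0` for `F(√−1)`, `F` cubic» + PRINT⁵ + MuIneqʳ):
  ICM6 on `S₃`-cubics = «Iwasawa's `μ₂ = 0` for `F`» ∧ «bounded narrow `2`-defect» = in Kida's notation `μ₂⁺(F) = 0` for the NARROW `2`-class groups — for complex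
  cubics the defect clause is implied (`…CubicFieldsAsTwoTorsionFields` §2), for totally real cubics it is the «signed object at `2`» (unit signatures) of the cell's
  charter; conjectured with `λ⁺ = μ⁺ = 0` (Greenberg 1976; Kida 1982 Remark (ii)), OPEN IN PRINT for non-abelian `F`. Nothing closed; BSD is NOT proved.

References: [Kida1982JFields] Thm. 1 (p. 340), its proof p. 343, Remark (ii) p. 341; [Iwasawa1973MuInvariants] Thm. 2/3, §3–§4; [Washington1997] §13.1, §13.3
Prop. 13.22–13.23; [FrohlichTaylor1990] Ch. V §1 (1.12); [Gras2003] IV.4; tree: `…PointFieldCarrierCMIff` §7, `NarrowDefectBoundedOfClassicalMuAdjoinI`,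
`…CubicFieldsAsTwoTorsionFields`, `NarrowClassNumberLayerTransportAlgEquivTwo`, `…SharedCubicDivisionField`.
-/

-- the Theorems namespace of this sub repeats the summit name by design (D-0017 nested layout)
set_option linter.dupNamespace false
set_option autoImplicit false

noncomputable section

open scoped Classical NumberField IntermediateField

namespace Summit.BirchSwinnertonDyer.BirchSwinnertonDyer.Theorems.AlignedTransportAtTwoCubicFieldsNarrowCurrency

open NumberField Polynomial WeierstrassCurve IntermediateField Field
  Literature.NumberTheory.EllipticCurves Literature.NumberTheory.EllipticCurves.Greenberg1999
  Literature.NumberTheory.EllipticCurves.DokchitserDokchitser2012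
  Literature.NumberTheory.EllipticCurves.ZpExtension Literature.NumberTheory.GaloisRepresentations
  Literature.NumberTheory.IwasawaTheory Literature.NumberTheory.NumberFields
  Summit.BirchSwinnertonDyer.Rank1Residual.F1Sign2
  Summit.BirchSwinnertonDyer.BirchSwinnertonDyer.Theorems.AlignedTransportAtTwoFineRoad.DivisionCubic
  Summit.BirchSwinnertonDyer.BirchSwinnertonDyer.Theorems.AlignedTransportAtTwoPointFieldCarrierCM
  Summit.BirchSwinnertonDyer.BirchSwinnertonDyer.Theorems.AlignedTransportAtTwoPointFieldCarrierCMIff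
  Summit.BirchSwinnertonDyer.BirchSwinnertonDyer.Theorems.AlignedTransportAtTwoSharedCubicDivisionField
  Summit.BirchSwinnertonDyer.BirchSwinnertonDyer.Theorems.AlignedTransportAtTwoCMSexticCurrency
  Summit.BirchSwinnertonDyer.BirchSwinnertonDyer.Theorems.AlignedTransportAtTwoCubicFieldsAsTwoTorsionFields

/-- `Δ(W_{A,B,C}) ∈ ℚ²` iff `disc ∈ ℚ²` and `2Δ(W_{A,B,C}) ∈ ℚ²` iff `2·disc ∈ ℚ²` (square factor `256`). [folklore] -/
theorem isSquare_Δ_universal_iff (A B C : ℚ) :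
    (IsSquare ((⟨0, A / 4, 0, B / 16, C / 64⟩ : WeierstrassCurve ℚ).Δ) ↔
        IsSquare (A ^ 2 * B ^ 2 - 4 * B ^ 3 - 4 * A ^ 3 * C - 27 * C ^ 2 + 18 * A * B * C)) ∧
      (IsSquare (2 * (⟨0, A / 4, 0, B / 16, C / 64⟩ : WeierstrassCurve ℚ).Δ) ↔
        IsSquare (2 * (A ^ 2 * B ^ 2 - 4 * B ^ 3 - 4 * A ^ 3 * C - 27 * C ^ 2 + 18 * A * B * C))) := by
  rw [Δ_universal]
  refine ⟨⟨?_, ?_⟩, ⟨?_, ?_⟩⟩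
  · rintro ⟨r, hr⟩; exact ⟨16 * r, by linear_combination (256 : ℚ) * hr⟩
  · rintro ⟨r, hr⟩; exact ⟨r / 16, by linear_combination hr / 256⟩
  · rintro ⟨r, hr⟩; exact ⟨16 * r, by linear_combination (256 : ℚ) * hr⟩
  · rintro ⟨r, hr⟩; exact ⟨r / 16, by linear_combination hr / 256⟩

/-- ★★★ **W-FREE KIDA CURRENCY, both signatures.** `F` a cubic number field containing `e` with `e³ + Ae² + Be + C = 0`, where `x³ + Ax² + Bx + C` has no
rational root and its discriminant `D = A²B² − 4B³ − 4A³C − 27C² + 18ABC` satisfies `D ∉ ℚ²` (`S₃`), `2D ∉ ℚ²`, `−2D ∉ ℚ²`; `F′/F` a quadratic extension containing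
`i` with `i² = −1`. Then **«`μ = 0` for every cyclotomic `ℤ₂`-extension of `F′`» ⟺ «`μ = 0` for every cyclotomic `ℤ₂`-extension of `F`» ∧ «for some `D₀`, every
cyclotomic `ℤ₂`-extension `κ` of `F` and every layer `n`: `ord₂ h⁺(F_n) ≤ ord₂ h(F_n) + D₀`»** — the kernel form of Kida 1982 Thm. 1 (⟸) and its converse (⟹,
att-p4 g26), with no elliptic curve and no `ℚ̄`-model in the statement. [cite: Kida1982JFields, Thm. 1 and its proof (p. 343)]
[cite: Iwasawa1973MuInvariants, Thm. 2 and Thm. 3, §3–§4] [cite: Washington1997, §13.3 Prop. 13.22–13.23] [cite: FrohlichTaylor1990, Ch. V §1 (1.12), p. 164] -/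
theorem forall_classicalMuVanishes_quadratic_iff_narrow_of_cubic
    (F F' : Type) [Field F] [NumberField F] [Field F'] [NumberField F'] [Algebra F F']
    (hF : Module.finrank ℚ F = 3) (hFF' : Module.finrank F F' = 2) {i : F'} (hi : i ^ 2 = -1)
    {A B C : ℚ} {e : F} (he : e ^ 3 + algebraMap ℚ F A * e ^ 2 + algebraMap ℚ F B * e + algebraMap ℚ F C = 0)
    (hirr : ∀ x : ℚ, x ^ 3 + A * x ^ 2 + B * x + C ≠ 0)
    (hDsq : ¬ IsSquare (A ^ 2 * B ^ 2 - 4 * B ^ 3 - 4 * A ^ 3 * C - 27 * C ^ 2 + 18 * A * B * C))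
    (h2D : ¬ IsSquare (2 * (A ^ 2 * B ^ 2 - 4 * B ^ 3 - 4 * A ^ 3 * C - 27 * C ^ 2 + 18 * A * B * C)))
    (hm2D : ¬ IsSquare (-2 * (A ^ 2 * B ^ 2 - 4 * B ^ 3 - 4 * A ^ 3 * C - 27 * C ^ 2 + 18 * A * B * C))) :
    (∀ κ' : ZpExtension F' 2, κ'.IsCyclotomic → ClassicalMuVanishes κ') ↔
      ((∀ κ : ZpExtension F 2, κ.IsCyclotomic → ClassicalMuVanishes κ) ∧
        ∃ D₀ : ℕ, ∀ κ : ZpExtension F 2, κ.IsCyclotomic → ∀ n : ℕ, ∀ [NumberField ↥(κ.layer n)],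
          padicValNat 2 (narrowClassNumber ↥(κ.layer n)) ≤ padicValNat 2 (classNumber ↥(κ.layer n)) + D₀) := by
  set W : WeierstrassCurve ℚ := ⟨0, A / 4, 0, B / 16, C / 64⟩ with hW
  have hD0 : A ^ 2 * B ^ 2 - 4 * B ^ 3 - 4 * A ^ 3 * C - 27 * C ^ 2 + 18 * A * B * C ≠ 0 := fun h ↦ hDsq (by rw [h]; exact ⟨0, by ring⟩)
  haveI : W.IsElliptic := isElliptic_universal A B C hD0
  have ht : ∀ x : ℚ, ¬ HasRationalTwoTorsionX W x := not_hasRationalTwoTorsionX_universal A B C hirr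
  have hsq : ¬ IsSquare W.Δ := fun h ↦ hDsq ((isSquare_Δ_universal_iff A B C).1.mp h)
  have h2Δ : ¬ IsSquare (2 * W.Δ) := fun h ↦ h2D ((isSquare_Δ_universal_iff A B C).2.mp h)
  have hm2Δ : ¬ IsSquare (-2 * W.Δ) := fun h ↦ hm2D ((isSquare_neg_two_mul_Δ_universal_iff A B C).mp h)
  have heW : aeval e (twoDivisionUCubic W) = 0 := aeval_twoDivisionUCubic_universal_eq_zero A B C he
  obtain ⟨i₀, hi₀⟩ : ∃ i₀ : AlgebraicClosure ℚ, i₀ ^ 2 = -1 := IsAlgClosed.exists_pow_nat_eq (-1) two_pos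
  -- the cubic model `ℚ⟮β₀⟯ ≃ₐ[ℚ] F`, of odd degree (`√2 ∉`)
  haveI : FiniteDimensional ℚ ↥ℚ⟮xT W two_ne_zero 0⟯ :=
    adjoin.finiteDimensional ((AlgebraicClosure.isAlgebraic ℚ).isAlgebraic _).isIntegral
  haveI : NumberField ↥ℚ⟮xT W two_ne_zero 0⟯ := NumberField.mk
  obtain ⟨φ⟩ := nonempty_algEquiv_adjoin_xT W ht hF heW 0
  have hodd : Odd (Module.finrank ℚ ↥ℚ⟮xT W two_ne_zero 0⟯) := by rw [finrank_adjoin_xT_model W ht 0]; decide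
  have h2 : ∀ x : ↥ℚ⟮xT W two_ne_zero 0⟯, x ^ 2 ≠ 2 := sq_ne_two_of_odd_finrank hodd
  rw [← forall_classicalMuVanishes_sup_adjoin_I_iff_cmSextic W ht (finrank_eq_six_of_quadratic_over_cubic hF hFF')
      (aeval_algebraMap_twoDivisionUCubic W heW) hi hsq h2Δ hm2Δ hi₀,
    classicalMuVanishes_sup_adjoin_I_iff_classicalMu_and_narrowDefect_le_cubic W ht hsq h2Δ hm2Δ hi₀ 0,
    forall_classicalMuVanishes_iff_adjoin_xT_of_root W ht hF heW 0,
    exists_narrowDefect_le_iff_of_algEquiv_of_forall_sq_ne_two φ h2]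

end Summit.BirchSwinnertonDyer.BirchSwinnertonDyer.Theorems.AlignedTransportAtTwoCubicFieldsNarrowCurrency

end
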